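import Summits.QuantumFields.BalabanUV.Beta.EriceRemainderEnclosureHistoryAutonomyComparisonAgeCompositionDecayBudgetWindow
import Summits.QuantumFields.BalabanUV.Beta.EriceRemainderEnclosureHistoryAutonomyComparisonAgeCompositionDecaySlotCertificate

/-!
# EriceRemainderEnclosureHistoryAutonomyComparisonAgeCompositionDecaySlotFlow — (E85d) route (N), first order: THE DEEP SLOTS OF THE (S-d) BUDGET ALONG A
# TWO-AGE FLOW — every slot of a pin of depth `≥ 3` pays its window damping, its lag-zero part and its defect part out of its step credit and hands the
# surplus `(4∕3)d_{p+1}` to the boundary, by the scalar certificates of (E85a) instantiated at the flow's level ratios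

Cell `pub-balaban`, β-function sub-cell, BINDER row D4 «RemainderConst leaves for Bałaban's split» (`HOME/BINDER-OWNERS.md`; owner lineage `b2b-balaban-beta-an4`;
this file by co-owner #2 lineage `b2b-balaban-beta-d4-p2`, generation 76), β-FLOW TEAM duty (1), FREEZE (0) honoured (def-free; imports (E84d) `…DecayBudgetWindow`
and (E85a) `…DecaySlotCertificate`; uses (E48a) `strictAnti_of_memFlow`, (E58b) `increment_anti`, (E82b) `load_le_half_step` ∕ `step_le_of_window` ∕ `load_le_of_window`,
(E84c) `step_ge_reads` ∕ `defect_up_le` ∕ `step_le_inv`, (E84d) `rise_ge_window_reads` ∕ `read_ge_of_tangent` and (E85a) `young_slot_cert` ∕ `old_slot_cert` ∕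
`old_slot_two_cert` BY NAME; nothing restated).  Successor item (E84d-2) of README `HOME/b2b-balaban-beta-d4-p2/g75/e84/README.md`, slots of depth `≥ 3`.

HONEST FRAMING (page 1, verbatim and binding).  *"Discharging BetaPertH makes Bałaban's UV stability UNCONDITIONAL — a real constructive-QFT result; it is
NOT the continuum limit and NOT the Clay problem."*  THIS FILE DISCHARGES NOTHING OF THE KIND.  Elementary real analysis about ABSTRACT functionals on a box
]0,γ]^ℕ with displayed floors, profiles and signs, and the FIRST-ORDER renewal objects of route (N) built from them — hypotheses of a census, not facts; the
form, signs, ages and moments of Bałaban's (1.22) limit functional are NOT PRINTED ([I] p. 298; GAPS G-t4-U2-1∕-2) and NOT asserted.  Row D4 class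
UNCHANGED (critical-path width 0; instance 0∕1; D4 DISCHARGE NO DATE).  HONEST DEPENDENCY: continuum YM on T⁴ ⇐ BetaPertH ∧ nine spine estimates (0/9
proved); BetaPertH ⇐ (D1) ∧ (D4) ∧ CAP+tail; G-an2-4 gates asym, D1 and NE2/3/4.

THE POINT (census sense (α); route (N); README `HOME/b2b-balaban-beta-d4-p2/g76/e85/README.md`).  (E84c) `budget_of_slots` cuts the linearised (S-d) budget of a
pin `m` into slots `p ∈ [m+2, m+2+k)` and a boundary.  §2 **`slot_deep`**: along every box solution of an isotone memory with floor dominated by a two-age profile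
`{1, k}` (`K = k+1`), the slot of every pin `p = n+1` of depth `n ≥ 2` holds with the surplus `S_p = (4∕3)·d_{p+1}` (`d_n = L_1h_{n+1}³∕2`):
`F_{p−1} + c_p∕(1−c_p) + ϑ_pω_p + (4∕3)d_{p+1} ≤ (3∕2)(y_p + y_p²∕2)` — in the letters `c₁ = c_{p+1}`, `d₁ = d_{p+1}`, `t = h_{p+k}∕h_{p+k+1}`, `l = h_{p+k−1}∕h_{p+k}`,
`w = h_{p+1}∕h_{p+2}`, `v = h_p∕h_{p+1}`, `R = (h_{p+1}∕h_{p+k})²`, `x = kc_p`, `σ = 1 − (h_{p+k}∕h_p)²`, `q = h_{p+2k}∕h_{p+k}` the credit dominates `3c₁Rt² + 3d₁w²`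
(`step_ge_reads`), the defect is at most `(t²−1)(3∕(2t²)+1∕2)` (`defect_up_le`, `load_le_half_step`: the DEEP step and the deep load), the debits are
`F_{p−1} = d₁(vw)³ + c₁(lt)³`, `c_p = c₁t³ = x∕k`, and the inequality is `c₁·SO + d₁·SY ≥ 0` with (E85a)'s certificates, whose hypotheses are §1: `two_age_load`,
`relStep_anti` (consecutive relative steps decrease), `relStep_le_step` (a relative step below a pin is at most the pin's step), `read_sq_tangent` (the read `j ≤ k`
scales below a window within `(1+σ)^{−1∕2}` of the read at its top) and **`inner_rise_ge_reads`** (`2x(1−1∕k)Rq ≤ R − 1`: the inner rise dominates the `k−1` old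
reads inside it), plus (E82b)∕(E84c)'s window facts; for `k = 2` the old part `3c₁²w⁴t⁴` of the quadratic credit `(3∕4)y_p²` is kept (`old_slot_two_cert`); the final
bookkeeping is the pure linear combinations `combine_two` ∕ `combine_three`.  NOT CLAIMED: the first slot `p = m+2` and the boundary (next file, merged); anything
nonlinear; anything printed.

WHAT IS PROVED ([folklore]; 0 `def`, 0 sorry).  §1 `two_age_load`, `relStep_anti`, `relStep_le_step`, `read_sq_tangent`, **`inner_rise_ge_reads`**, `combine_two`,
`combine_three`; §2 **`slot_deep`**.
-/
noncomputable section
open Finset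

namespace Summit.QuantumFields.BalabanUV.Beta.EriceRemainderEnclosureHistoryAutonomyComparisonAgeCompositionDecaySlotFlow

open Literature.MathematicalPhysics.QuantumFieldTheory.Balaban1983to89
open Literature.MathematicalPhysics.QuantumFieldTheory.Balaban1983to89.T4BetaStationary
open Literature.MathematicalPhysics.QuantumFieldTheory.Balaban1983to89.T4BetaFlowWellPosed
open Summit.QuantumFields.BalabanUV.Beta.EriceRemainderEnclosureHistoryAutonomyOrder (strictAnti_of_memFlow)
open Summit.QuantumFields.BalabanUV.Beta.EriceRemainderEnclosureHistoryAutonomyComparisonAffineProfile (increment_anti)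
open Summit.QuantumFields.BalabanUV.Beta.EriceRemainderEnclosureHistoryAutonomyComparisonAgeCompositionYoungestTailSumFlow (load_le_half_step
  step_le_of_window load_le_of_window)
open Summit.QuantumFields.BalabanUV.Beta.EriceRemainderEnclosureHistoryAutonomyComparisonAgeCompositionDecayBudgetSlots (step_ge_reads defect_up_le
  step_le_inv)
open Summit.QuantumFields.BalabanUV.Beta.EriceRemainderEnclosureHistoryAutonomyComparisonAgeCompositionDecayBudgetWindow (rise_ge_window_reads
  read_ge_of_tangent)
open Summit.QuantumFields.BalabanUV.Beta.EriceRemainderEnclosureHistoryAutonomyComparisonAgeCompositionDecaySlotCertificate (young_slot_cert old_slot_cert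
  old_slot_two_cert)

variable {B : (ℕ → ℝ) → ℝ} {γ b gIR : ℝ} {L : ℕ → ℝ} {K : ℕ} {h : ℕ → ℝ}

/-! ## §1 Flow facts in the certificate's letters -/

/-- The two-age load: with the profile `{1, k}` (`K = k+1`, `L_j = 0` for `j ∉ {1,k}`), `Σ_{j<K} L_jh_{t+j}³∕2 = L_1h_{t+1}³∕2 + L_kh_{t+k}³∕2`. [folklore] -/
theorem two_age_load {k : ℕ} (hk2 : 2 ≤ k) (hKk : K = k + 1) (hL2 : ∀ j, j < K → j ≠ 1 → j ≠ k → L j = 0) (t : ℕ) :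
    ∑ j ∈ range K, L j * h (t + j) ^ 3 / 2 = L 1 * h (t + 1) ^ 3 / 2 + L k * h (t + k) ^ 3 / 2 := by
  have hsub : ({1, k} : Finset ℕ) ⊆ range K := by
    intro j hj; rw [mem_insert, mem_singleton] at hj; rw [mem_range]; rcases hj with rfl | rfl <;> omega
  rw [← sum_subset hsub, sum_pair (by omega : (1:ℕ) ≠ k)]
  intro j hj hjn
  rw [mem_insert, mem_singleton, not_or] at hjn
  rw [hL2 j (mem_range.mp hj) hjn.1 hjn.2]; ring

/-- Consecutive relative steps decrease: `(h_{n+1}∕h_{n+2})² − 1 ≤ (h_n∕h_{n+1})² − 1` (increments decrease, levels increase). [folklore] -/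
theorem relStep_anti (hmono : ∀ u v : ℕ → ℝ, SeqBox γ u → SeqBox γ v → (∀ j, u j ≤ v j) → B u ≤ B v) (hb : 0 < b)
    (hlo : ∀ u, SeqBox γ u → b ≤ B u) (hh : SeqBox γ h) (hf : MemFlow B gIR h) (n : ℕ) :
    (h (n + 1) / h (n + 2)) ^ 2 - 1 ≤ (h n / h (n + 1)) ^ 2 - 1 := by
  have hpos : ∀ n, 0 < h n := fun n => (hh n).1
  have hanti := (strictAnti_of_memFlow hb hlo hh hf).antitone
  have h0 := hpos n; have h1 := hpos (n + 1); have h2 := hpos (n + 2)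
  have e0 := hf.2 n
  have e1 := hf.2 (n + 1)
  have hinc := increment_anti hmono hb hlo hh hf (Nat.le_succ n)
  rw [show n + 1 + 1 = n + 2 from rfl] at e1 hinc
  have hD0 : 0 ≤ 1 / h (n + 1) ^ 2 - 1 / h n ^ 2 := by
    have : h (n + 1) ^ 2 ≤ h n ^ 2 := pow_le_pow_left₀ h1.le (hanti (Nat.le_succ n)) 2
    rw [sub_nonneg]; exact one_div_le_one_div_of_le (pow_pos h1 2) this
  have ez1 : (h (n + 1) / h (n + 2)) ^ 2 - 1 = h (n + 1) ^ 2 * (1 / h (n + 2) ^ 2 - 1 / h (n + 1) ^ 2) := by rw [div_pow]; field_simp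
  have ez0 : (h n / h (n + 1)) ^ 2 - 1 = h n ^ 2 * (1 / h (n + 1) ^ 2 - 1 / h n ^ 2) := by rw [div_pow]; field_simp
  rw [ez1, ez0]
  have hsq : h (n + 1) ^ 2 ≤ h n ^ 2 := pow_le_pow_left₀ h1.le (hanti (Nat.le_succ n)) 2
  calc h (n + 1) ^ 2 * (1 / h (n + 2) ^ 2 - 1 / h (n + 1) ^ 2) ≤ h (n + 1) ^ 2 * (1 / h (n + 1) ^ 2 - 1 / h n ^ 2) :=
        mul_le_mul_of_nonneg_left (by linarith) (sq_nonneg _)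
    _ ≤ h n ^ 2 * (1 / h (n + 1) ^ 2 - 1 / h n ^ 2) := mul_le_mul_of_nonneg_right hsq hD0

/-- A relative step below a pin is at most the pin's step: for `n + 1 ≤ m`, `(h_m∕h_{m+1})² − 1 ≤ 1 − (h_{n+1}∕h_n)²` (`Δ_m ≤ Δ_n`, `h_m ≤ h_{n+1}`). [folklore] -/
theorem relStep_le_step (hmono : ∀ u v : ℕ → ℝ, SeqBox γ u → SeqBox γ v → (∀ j, u j ≤ v j) → B u ≤ B v) (hb : 0 < b)
    (hlo : ∀ u, SeqBox γ u → b ≤ B u) (hh : SeqBox γ h) (hf : MemFlow B gIR h) {n m : ℕ} (hnm : n + 1 ≤ m) :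
    (h m / h (m + 1)) ^ 2 - 1 ≤ 1 - (h (n + 1) / h n) ^ 2 := by
  have hpos : ∀ n, 0 < h n := fun n => (hh n).1
  have hanti := (strictAnti_of_memFlow hb hlo hh hf).antitone
  have h0 := hpos n; have h1 := hpos (n + 1); have hm := hpos m; have hm1 := hpos (m + 1)
  have e0 := hf.2 n
  have em := hf.2 m
  have hinc := increment_anti hmono hb hlo hh hf (show n ≤ m by omega)
  have hD0 : 0 ≤ 1 / h (n + 1) ^ 2 - 1 / h n ^ 2 := by
    have : h (n + 1) ^ 2 ≤ h n ^ 2 := pow_le_pow_left₀ h1.le (hanti (Nat.le_succ n)) 2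
    rw [sub_nonneg]; exact one_div_le_one_div_of_le (pow_pos h1 2) this
  have ez : (h m / h (m + 1)) ^ 2 - 1 = h m ^ 2 * (1 / h (m + 1) ^ 2 - 1 / h m ^ 2) := by rw [div_pow]; field_simp
  have ey : 1 - (h (n + 1) / h n) ^ 2 = h (n + 1) ^ 2 * (1 / h (n + 1) ^ 2 - 1 / h n ^ 2) := by rw [div_pow]; field_simp
  rw [ez, ey]
  have hsq : h m ^ 2 ≤ h (n + 1) ^ 2 := pow_le_pow_left₀ hm.le (hanti hnm) 2
  calc h m ^ 2 * (1 / h (m + 1) ^ 2 - 1 / h m ^ 2) ≤ h m ^ 2 * (1 / h (n + 1) ^ 2 - 1 / h n ^ 2) :=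
        mul_le_mul_of_nonneg_left (by linarith) (sq_nonneg _)
    _ ≤ h (n + 1) ^ 2 * (1 / h (n + 1) ^ 2 - 1 / h n ^ 2) := mul_le_mul_of_nonneg_right hsq hD0

/-- The read at the bottom of the next window within the tangent factor: `1 ≤ (h_{n+k+j}∕h_{n+k})²·(1 + σ)` with `σ = 1 − (h_{n+k}∕h_n)²`, for `j ≤ k`
(`h_{n+k}² ≤ h_{n+k+j}²(1 + jE)`, `E = (h_{n+k}∕h_{n+k+1})² − 1 ≤ σ∕k`). [folklore] -/
theorem read_sq_tangent (hmono : ∀ u v : ℕ → ℝ, SeqBox γ u → SeqBox γ v → (∀ j, u j ≤ v j) → B u ≤ B v) (hb : 0 < b)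
    (hlo : ∀ u, SeqBox γ u → b ≤ B u) (hh : SeqBox γ h) (hf : MemFlow B gIR h) (n k j : ℕ) (hjk : j ≤ k) :
    1 ≤ (h (n + k + j) / h (n + k)) ^ 2 * (1 + (1 - (h (n + k) / h n) ^ 2)) := by
  have hpos : ∀ n, 0 < h n := fun n => (hh n).1
  have hanti := (strictAnti_of_memFlow hb hlo hh hf).antitone
  have hnk := hpos (n + k); have hnkj := hpos (n + k + j)
  have ht := read_ge_of_tangent hmono hb hlo hh hf (n + k) j
  have hs := step_le_of_window hmono hb hlo hh hf n k
  have hE0 : 0 ≤ (h (n + k) / h (n + k + 1)) ^ 2 - 1 := by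
    have : 1 ≤ h (n + k) / h (n + k + 1) := by rw [le_div_iff₀ (hpos _), one_mul]; exact hanti (by omega)
    nlinarith
  have hjk' : (j : ℝ) ≤ k := by exact_mod_cast hjk
  have h1 : (j : ℝ) * ((h (n + k) / h (n + k + 1)) ^ 2 - 1) ≤ 1 - (h (n + k) / h n) ^ 2 :=
    (mul_le_mul_of_nonneg_right hjk' hE0).trans hs
  have h2 : h (n + k) ^ 2 ≤ h (n + k + j) ^ 2 * (1 + (1 - (h (n + k) / h n) ^ 2)) :=
    ht.trans (mul_le_mul_of_nonneg_left (by linarith) (sq_nonneg _))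
  rw [div_pow, div_mul_eq_mul_div, le_div_iff₀ (pow_pos hnk 2), one_mul]
  exact h2

/-- **THE INNER RISE DOMINATES THE OLD READS INSIDE IT**: with `x = k·L_kh_{n+k}³∕2`, `R = (h_{n+1}∕h_{n+k})²`, `q = h_{n+2k}∕h_{n+k}` (ages `1 ≠ k`, both `< K`,
`k ≥ 1`):  `2x(1 − 1∕k)·R·q ≤ R − 1` — (E84d) `rise_ge_window_reads` on `[n+1, n+k)` keeping the `k−1` old reads, each at least the read `h_{n+2k}`. [folklore] -/
theorem inner_rise_ge_reads (hL : ∀ k, 0 ≤ L k) (hb : 0 < b) (hlo : ∀ u, SeqBox γ u → b ≤ B u)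
    (hdom : ∀ u, SeqBox γ u → ∑ k ∈ range K, L k * u k ≤ B u)
    (hh : SeqBox γ h) (hf : MemFlow B gIR h) {k : ℕ} (h1K : 1 < K) (hkK : k < K) (hk1 : 1 ≤ k) (hk1' : k ≠ 1) (n : ℕ) :
    2 * ((k : ℝ) * (L k * h (n + k) ^ 3 / 2)) * (1 - 1 / k) * (h (n + 1) / h (n + k)) ^ 2 * (h (n + 2 * k) / h (n + k))
      ≤ (h (n + 1) / h (n + k)) ^ 2 - 1 := by
  have hpos : ∀ n, 0 < h n := fun n => (hh n).1
  have hanti := (strictAnti_of_memFlow hb hlo hh hf).antitone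
  have hkr : (0 : ℝ) < k := by exact_mod_cast (show 0 < k by omega)
  have hrise := rise_ge_window_reads hL hdom hh hf h1K hkK hk1' (n + 1) (k - 1)
  rw [show n + 1 + (k - 1) = n + k by omega] at hrise
  have hold : ((k : ℝ) - 1) * (L k * h (n + 2 * k)) ≤ ∑ q ∈ range (k - 1), (L 1 * h (n + 1 + q + 2) + L k * h (n + 1 + q + k + 1)) := by
    have : ∑ q ∈ range (k - 1), L k * h (n + 2 * k) ≤ ∑ q ∈ range (k - 1), (L 1 * h (n + 1 + q + 2) + L k * h (n + 1 + q + k + 1)) :=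
      sum_le_sum fun q hq => by
        have hq' := mem_range.mp hq
        have h1 : 0 ≤ L 1 * h (n + 1 + q + 2) := mul_nonneg (hL 1) (hpos _).le
        have h2 : L k * h (n + 2 * k) ≤ L k * h (n + 1 + q + k + 1) := mul_le_mul_of_nonneg_left (hanti (by omega)) (hL k)
        linarith
    rwa [sum_const, card_range, nsmul_eq_mul, Nat.cast_sub hk1, Nat.cast_one] at this
  have hcomb := (mul_le_mul_of_nonneg_left hold (sq_nonneg (h (n + 1)))).trans hrise
  have hnk := hpos (n + k)
  have e : 2 * ((k : ℝ) * (L k * h (n + k) ^ 3 / 2)) * (1 - 1 / k) * (h (n + 1) / h (n + k)) ^ 2 * (h (n + 2 * k) / h (n + k))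
      = h (n + 1) ^ 2 * (((k : ℝ) - 1) * (L k * h (n + 2 * k))) := by
    rw [div_pow]; field_simp
  rw [e]; exact hcomb

/-- Bookkeeping of the deep slot for `k = 2` (pure linear combination). [folklore] -/
theorem combine_two {c1 d1 t w v x Y k : ℝ} (hk : k = 2)
    (key : 0 ≤ c1 * (3 * w ^ 2 * t ^ 2 + 3 / 2 * x * w ^ 4 * t - w ^ 3 * t ^ 3 - t ^ 3 / (1 - x / 2)
        - 2 * (t ^ 2 - 1) * (3 * t + t ^ 3) / (2 * (1 - x))))
    (hcredit : 2 * d1 * w ^ 2 + 2 * c1 * w ^ 2 * t ^ 2 ≤ Y) (hquad : 3 * c1 ^ 2 * w ^ 4 * t ^ 4 ≤ 3 / 2 * (Y ^ 2 / 2))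
    (equad : c1 * (3 / 2 * x * w ^ 4 * t) = 3 * c1 ^ 2 * w ^ 4 * t ^ 4) (hdSY : 0 ≤ d1 * (3 * w ^ 2 - ((v * w) ^ 3 + 4 / 3))) :
    d1 * (v * w) ^ 3 + c1 * (w * t) ^ 3 + c1 * (t ^ 3 / (1 - x / k)) + c1 * (k * (t ^ 2 - 1) * (3 * t + t ^ 3) / (2 * (1 - x)))
      + 4 / 3 * d1 ≤ 3 / 2 * (Y + Y ^ 2 / 2) := by
  subst hk
  have e1 : c1 * (w * t) ^ 3 = c1 * (w ^ 3 * t ^ 3) := by ring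
  have e2 : d1 * (v * w) ^ 3 = d1 * (3 * w ^ 2) - d1 * (3 * w ^ 2 - ((v * w) ^ 3 + 4 / 3)) - 4 / 3 * d1 := by ring
  rw [e1, e2]
  nlinarith [key, hcredit, hquad, equad, hdSY]

/-- Bookkeeping of the deep slot for `k ≥ 3` (pure linear combination). [folklore] -/
theorem combine_three {c1 d1 t l w v x Y R k : ℝ}
    (key : 0 ≤ c1 * (3 * R * t ^ 2 - l ^ 3 * t ^ 3 - t ^ 3 / (1 - x / k) - k * (t ^ 2 - 1) * (3 * t + t ^ 3) / (2 * (1 - x))))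
    (hcredit : 2 * d1 * w ^ 2 + 2 * c1 * R * t ^ 2 ≤ Y) (hdSY : 0 ≤ d1 * (3 * w ^ 2 - ((v * w) ^ 3 + 4 / 3))) :
    d1 * (v * w) ^ 3 + c1 * (l * t) ^ 3 + c1 * (t ^ 3 / (1 - x / k)) + c1 * (k * (t ^ 2 - 1) * (3 * t + t ^ 3) / (2 * (1 - x)))
      + 4 / 3 * d1 ≤ 3 / 2 * (Y + Y ^ 2 / 2) := by
  have e1 : c1 * (l * t) ^ 3 = c1 * (l ^ 3 * t ^ 3) := by ring
  rw [e1]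
  nlinarith [key, hcredit, hdSY, sq_nonneg Y]

/-! ## §2 The deep slot along the flow -/
set_option maxHeartbeats 400000 in
/-- **A DEEP SLOT OF THE (S-d) BUDGET ALONG A TWO-AGE FLOW.**  Two-age profile `{1, k}` (`2 ≤ k`, `K = k+1`), `h` a box solution of an isotone memory with
floor dominated by `L ≥ 0`, a pin `p = n+1` of depth `n ≥ 2`; `c_p = L_kh_{p+k}³∕2`, `x_p = kc_p`, the loads `F_t = Σ_jL_jh_{t+j}³∕2`, the defect
`ϑ_p = 1 − (h_{p+k+1}∕h_{p+k})³∕(1+F_{p+k+1})`.  THEN the slot of `p` in (E84c) `budget_of_slots` holds with the surplus `S_p = (4∕3)d_{p+1}`: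
`F_{p−1} + c_p∕(1−c_p) + ϑ_p·x_p∕(1−x_p) + (4∕3)·L_1h_{p+2}³∕2 ≤ (3∕2)(y_p + y_p²∕2)`, `y_p = 1 − (h_{p+1}∕h_p)²`.  PROOF: the credit dominates
`3c₁Rt² + 3d₁w²` ((E84c) `step_ge_reads`; `c₁ = c_{p+1}`, `d₁ = d_{p+1}`), the defect `ϑ_p ≤ (t²−1)(3∕(2t²) + 1∕2)` ((E84c) `defect_up_le`, (E82b) `load_le_half_step`),
and the remainder splits as `c₁·SO + d₁·SY` with (E85a) `young_slot_cert`, `old_slot_cert` (`k ≥ 3`) ∕ `old_slot_two_cert` (`k = 2`, using also the old part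
`3c₁²R²t⁴` of the quadratic credit) at the flow's ratios, whose hypotheses are §1 and the window facts of (E82b)∕(E84c)∕(E84d). [folklore] -/
theorem slot_deep (hmono : ∀ u v : ℕ → ℝ, SeqBox γ u → SeqBox γ v → (∀ j, u j ≤ v j) → B u ≤ B v)
    (hL : ∀ k, 0 ≤ L k) (hb : 0 < b) (hlo : ∀ u, SeqBox γ u → b ≤ B u) (hdom : ∀ u, SeqBox γ u → ∑ k ∈ range K, L k * u k ≤ B u)
    (hh : SeqBox γ h) (hf : MemFlow B gIR h) {k : ℕ} (hk2 : 2 ≤ k) (hKk : K = k + 1) (hL2 : ∀ j, j < K → j ≠ 1 → j ≠ k → L j = 0)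
    {n : ℕ} (hn : 2 ≤ n) :
    (∑ j ∈ range K, L j * h (n + j) ^ 3 / 2) + (L k * h (n + 1 + k) ^ 3 / 2) / (1 - L k * h (n + 1 + k) ^ 3 / 2)
      + (1 - (h (n + 1 + k + 1) / h (n + 1 + k)) ^ 3 / (1 + ∑ j ∈ range K, L j * h (n + 1 + k + 1 + j) ^ 3 / 2))
        * (((k : ℝ) * (L k * h (n + 1 + k) ^ 3 / 2)) / (1 - (k : ℝ) * (L k * h (n + 1 + k) ^ 3 / 2)))
      + 4 / 3 * (L 1 * h (n + 1 + 2) ^ 3 / 2)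
      ≤ 3 / 2 * ((1 - (h (n + 1 + 1) / h (n + 1)) ^ 2) + (1 - (h (n + 1 + 1) / h (n + 1)) ^ 2) ^ 2 / 2) := by
  have hpos : ∀ n, 0 < h n := fun n => (hh n).1
  have hanti := (strictAnti_of_memFlow hb hlo hh hf).antitone
  have hkK : k < K := by omega
  have h1K : 1 < K := by omega
  have hk1 : k ≠ 1 := by omega
  have hkr : (2 : ℝ) ≤ k := by exact_mod_cast hk2
  have hk0 : (0 : ℝ) < k := by linarith
  rw [show n + 1 + 1 = n + 2 from rfl, show n + 1 + 2 = n + 3 from rfl, show n + 1 + k + 1 = n + k + 2 by omega]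
  have P1 := hpos (n + 1); have P2 := hpos (n + 2); have P3 := hpos (n + 3); have Pk := hpos (n + k); have Pk1 := hpos (n + 1 + k)
  have Pk2 := hpos (n + k + 2)
  have hy4 : 1 - (h (n + 2) / h (n + 1)) ^ 2 ≤ 1 / 4 := by
    have hy := step_le_inv hmono hb hlo hh hf (n + 1)
    have hn2 : (2:ℝ) ≤ n := by exact_mod_cast hn
    have : 1 / ((((n + 1 : ℕ)) : ℝ) + 1) ≤ 1 / 4 := by
      rw [div_le_div_iff₀ (by positivity) (by norm_num)]; push_cast; linarith
    exact hy.trans this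
  have hy0 : 0 ≤ 1 - (h (n + 2) / h (n + 1)) ^ 2 := by
    have h1 : h (n + 2) / h (n + 1) ≤ 1 := (div_le_one P1).mpr (hanti (by omega))
    have h0 : 0 ≤ h (n + 2) / h (n + 1) := div_nonneg P2.le P1.le
    nlinarith
  have hreads := step_ge_reads hL hdom hh hf h1K hkK hk1 (n + 1)
  rw [show n + 1 + 1 = n + 2 from rfl, show n + 1 + 2 = n + 3 from rfl, show n + 1 + k + 1 = n + k + 2 by omega] at hreads
  have hz2 := relStep_le_step hmono hb hlo hh hf (show n + 1 + 1 ≤ n + 2 by omega)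
  rw [show n + 2 + 1 = n + 3 from rfl, show n + 1 + 1 = n + 2 from rfl] at hz2
  have hF0 : 0 ≤ ∑ j ∈ range K, L j * h (n + k + 2 + j) ^ 3 / 2 :=
    sum_nonneg fun j _ => by have := hL j; have := hpos (n + k + 2 + j); positivity
  have hhalf := load_le_half_step hL hb hlo hdom hh hf (n + 1 + k); rw [show n + 1 + k + 1 = n + k + 2 by omega] at hhalf
  have hwin := load_le_of_window hmono hL hb hlo hdom hh hf (show 1 ≤ n + 1 by omega) hkK
  have hstep := step_le_of_window hmono hb hlo hh hf (n + 1) k; rw [show n + 1 + k + 1 = n + k + 2 by omega] at hstep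
  have eF := two_age_load (h := h) hk2 hKk hL2 n
  set c1 := L k * h (n + k + 2) ^ 3 / 2 with hc1
  set d1 := L 1 * h (n + 3) ^ 3 / 2 with hd1
  set t := h (n + 1 + k) / h (n + k + 2) with ht
  set l := h (n + k) / h (n + 1 + k) with hl
  set w := h (n + 2) / h (n + 3) with hw
  set v := h (n + 1) / h (n + 2) with hv
  set R := (h (n + 2) / h (n + 1 + k)) ^ 2 with hR
  set x := (k : ℝ) * (L k * h (n + 1 + k) ^ 3 / 2) with hx
  set σ := 1 - (h (n + 1 + k) / h (n + 1)) ^ 2 with hσ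
  set q := h (n + 1 + 2 * k) / h (n + 1 + k) with hq
  clear_value c1 d1 t l w v R x σ q
  have hc10 : 0 ≤ c1 := by rw [hc1]; have := hL k; positivity
  have hd10 : 0 ≤ d1 := by rw [hd1]; have := hL 1; positivity
  have ht1 : 1 ≤ t := by rw [ht, le_div_iff₀ Pk2, one_mul]; exact hanti (by omega)
  have hl1 : 1 ≤ l := by rw [hl, le_div_iff₀ Pk1, one_mul]; exact hanti (by omega)
  have hw1 : 1 ≤ w := by rw [hw, le_div_iff₀ P3, one_mul]; exact hanti (by omega)
  have hv1 : 1 ≤ v := by rw [hv, le_div_iff₀ P2, one_mul]; exact hanti (by omega)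
  have hR1 : 1 ≤ R := by
    have : 1 ≤ h (n + 2) / h (n + 1 + k) := by rw [le_div_iff₀ Pk1, one_mul]; exact hanti (by omega)
    rw [hR]; nlinarith
  have ht0 : 0 < t := by linarith
  have hv0 : 0 < v := by linarith
  have htl : t ≤ l := by
    have h1 := relStep_anti hmono hb hlo hh hf (n + k)
    rw [show n + k + 1 = n + 1 + k by ring] at h1
    have : t ^ 2 ≤ l ^ 2 := by rw [ht, hl]; linarith only [h1]
    exact (pow_le_pow_iff_left₀ ht0.le (le_trans zero_le_one hl1) two_ne_zero).mp this
  have hly : l ^ 2 ≤ 5 / 4 := by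
    have h1 := relStep_le_step hmono hb hlo hh hf (show n + 1 + 1 ≤ n + k by omega)
    rw [show n + k + 1 = n + 1 + k by ring, show n + 1 + 1 = n + 2 from rfl] at h1
    rw [hl]; linarith only [h1, hy4]
  have hlR : l ^ 2 ≤ R := by
    rw [hl, hR, div_pow, div_pow]
    exact div_le_div_of_nonneg_right (pow_le_pow_left₀ Pk.le (hanti (by omega)) 2) (by positivity)
  have hlσ : ((k : ℝ) - 1) * (l ^ 2 - 1) ≤ σ := by
    obtain ⟨j, hj⟩ : ∃ j, k = j + 1 := ⟨k - 1, by omega⟩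
    have h1 := step_le_of_window hmono hb hlo hh hf (n + 1) j
    have ej : (j : ℝ) = k - 1 := by rw [hj]; push_cast; ring
    rw [show n + 1 + j = n + k by omega, show n + k + 1 = n + 1 + k by omega, ej] at h1
    rw [hl, hσ]
    refine h1.trans ?_
    have h2 : (h (n + 1 + k) / h (n + 1)) ^ 2 ≤ (h (n + k) / h (n + 1)) ^ 2 := by
      rw [div_pow, div_pow]; exact div_le_div_of_nonneg_right (pow_le_pow_left₀ Pk1.le (hanti (by omega)) 2) (by positivity)
    linarith only [h2]
  have hq0 : 0 < q := by rw [hq]; exact div_pos (hpos _) Pk1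
  have hq1 : 1 ≤ q ^ 2 * (1 + σ) := by
    have h1 := read_sq_tangent hmono hb hlo hh hf (n + 1) k k le_rfl
    rw [hq, hσ]; rwa [show n + 1 + k + k = n + 1 + 2 * k by ring] at h1
  have hCin : 2 * x * (1 - 1 / k) * R * q ≤ R - 1 := by
    have h1 := inner_rise_ge_reads hL hb hlo hdom hh hf h1K hkK (by omega) hk1 (n + 1)
    rw [hx, hR, hq]; rwa [show n + 1 + 1 = n + 2 from rfl] at h1
  have htw2 : k = 2 → t ≤ w := by
    intro hk
    have h1 := relStep_anti hmono hb hlo hh hf (n + 2)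
    rw [show n + 2 + 1 = n + 1 + k by omega, show n + 2 + 2 = n + k + 2 by omega] at h1
    have : t ^ 2 ≤ w ^ 2 := by rw [ht, hw, show n + 3 = n + 1 + k by omega]; linarith only [h1]
    exact (pow_le_pow_iff_left₀ ht0.le (le_trans zero_le_one hw1) two_ne_zero).mp this
  have ecp : L k * h (n + 1 + k) ^ 3 / 2 = c1 * t ^ 3 := by rw [hc1, ht, div_pow]; field_simp
  have exk : x / k = c1 * t ^ 3 := by rw [hx, ← ecp]; field_simp
  have eold : L k * h (n + k) ^ 3 / 2 = c1 * (l * t) ^ 3 := by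
    rw [hc1, hl, ht, mul_pow, div_pow, div_pow]; field_simp
  have eyng : L 1 * h (n + 1) ^ 3 / 2 = d1 * (v * w) ^ 3 := by
    rw [hd1, hv, hw, mul_pow, div_pow, div_pow]; field_simp
  have ev2 : (h (n + 2) / h (n + 1)) ^ 2 = 1 / v ^ 2 := by rw [hv, div_pow, div_pow, one_div_div]
  have hv2 : v ^ 2 ≤ 4 / 3 := by
    have h34 : 3 / 4 ≤ 1 / v ^ 2 := by rw [← ev2]; linarith
    rw [le_div_iff₀ (by positivity)] at h34; linarith
  have hvw : v ^ 2 * w ^ 2 ≤ 2 * v ^ 2 - 1 := by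
    rw [ev2] at hz2
    have hvv : 0 < v ^ 2 := by positivity
    have h1 : w ^ 2 ≤ 2 - 1 / v ^ 2 := by linarith
    have h2 := mul_le_mul_of_nonneg_left h1 hvv.le
    rw [mul_sub, mul_one_div_cancel hvv.ne'] at h2
    linarith
  have hw54 : w ^ 2 ≤ 5 / 4 := by
    have h1 : w ^ 2 * v ^ 2 ≤ 5 / 4 * v ^ 2 := by nlinarith only [hvw, hv2]
    exact le_of_mul_le_mul_right h1 (by positivity)
  have hcredit : 2 * d1 * w ^ 2 + 2 * c1 * R * t ^ 2 ≤ 1 - (h (n + 2) / h (n + 1)) ^ 2 := by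
    have e1 : L 1 * h (n + 2) ^ 2 * h (n + 3) = 2 * d1 * w ^ 2 := by rw [hd1, hw, div_pow]; field_simp
    have e2 : L k * h (n + 2) ^ 2 * h (n + k + 2) = 2 * c1 * R * t ^ 2 := by rw [hc1, hR, ht, div_pow, div_pow]; field_simp
    linarith
  have hdef : 1 - (h (n + k + 2) / h (n + 1 + k)) ^ 3 / (1 + ∑ j ∈ range K, L j * h (n + k + 2 + j) ^ 3 / 2)
      ≤ (t ^ 2 - 1) * (3 / (2 * t ^ 2) + 1 / 2) := by
    have hs0 : 0 ≤ h (n + k + 2) / h (n + 1 + k) := div_nonneg Pk2.le Pk1.le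
    have hs1 : h (n + k + 2) / h (n + 1 + k) ≤ 1 := (div_le_one Pk1).mpr (hanti (by omega))
    have h1 := defect_up_le hs0 hs1 hF0
    have es : (h (n + k + 2) / h (n + 1 + k)) ^ 2 = 1 / t ^ 2 := by rw [ht, div_pow, div_pow, one_div_div]
    rw [es] at h1
    have e3 : (t ^ 2 - 1) * (3 / (2 * t ^ 2) + 1 / 2) = 3 / 2 * (1 - 1 / t ^ 2) + (t ^ 2 - 1) / 2 := by
      field_simp
    rw [e3]; linarith
  have hx0 : 0 ≤ x := by rw [hx]; have := hL k; positivity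
  have hxa : 4 * x ≤ 3 * σ := hwin
  have hσ1 : σ ≤ 1 := by rw [hσ]; linarith [sq_nonneg (h (n + 1 + k) / h (n + 1))]
  have hx1 : x < 1 := by linarith
  have hω0 : 0 ≤ x / (1 - x) := div_nonneg hx0 (by linarith)
  have hV : (1 - (h (n + k + 2) / h (n + 1 + k)) ^ 3 / (1 + ∑ j ∈ range K, L j * h (n + k + 2 + j) ^ 3 / 2)) * (x / (1 - x))
      ≤ (t ^ 2 - 1) * (3 / (2 * t ^ 2) + 1 / 2) * (x / (1 - x)) := mul_le_mul_of_nonneg_right hdef hω0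
  have hσR : σ ≤ 1 - 3 / (4 * R) := by
    have e : (h (n + 1 + k) / h (n + 1)) ^ 2 * R = (h (n + 2) / h (n + 1)) ^ 2 := by
      rw [hR, div_pow, div_pow, div_pow]; field_simp
    have h34 : 3 / 4 ≤ (h (n + 2) / h (n + 1)) ^ 2 := by linarith only [hy4]
    have hRpos : 0 < R := by linarith only [hR1]
    have es2 : (h (n + 1 + k) / h (n + 1)) ^ 2 = (h (n + 2) / h (n + 1)) ^ 2 / R := eq_div_of_mul_eq hRpos.ne' e
    have key : 3 / (4 * R) ≤ (h (n + 1 + k) / h (n + 1)) ^ 2 := by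
      rw [es2, ← div_div]; exact div_le_div_of_nonneg_right h34 hRpos.le
    rw [hσ]; linarith only [key]
  have hkt : (k : ℝ) * (t ^ 2 - 1) ≤ σ := hstep
  have hSY := young_slot_cert hv1 hv2 hw1 hvw
  rw [eyng, eold] at eF
  have eG : (L k * h (n + 1 + k) ^ 3 / 2) / (1 - L k * h (n + 1 + k) ^ 3 / 2) = c1 * (t ^ 3 / (1 - x / k)) := by
    rw [ecp, exk]; ring
  have ex : x = k * (c1 * t ^ 3) := by rw [hx, ecp]
  have e4 : t ^ 3 * (3 / (2 * t ^ 2) + 1 / 2) = (3 * t + t ^ 3) / 2 := by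
    have htne : t ≠ 0 := ht0.ne'
    field_simp
  have eV : (t ^ 2 - 1) * (3 / (2 * t ^ 2) + 1 / 2) * (x / (1 - x)) = c1 * ((k : ℝ) * (t ^ 2 - 1) * (3 * t + t ^ 3) / (2 * (1 - x))) := by
    rw [ex]
    calc (t ^ 2 - 1) * (3 / (2 * t ^ 2) + 1 / 2) * ((k : ℝ) * (c1 * t ^ 3) / (1 - (k : ℝ) * (c1 * t ^ 3)))
        = (t ^ 2 - 1) * k * c1 * (t ^ 3 * (3 / (2 * t ^ 2) + 1 / 2)) / (1 - (k : ℝ) * (c1 * t ^ 3)) := by ring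
      _ = (t ^ 2 - 1) * k * c1 * ((3 * t + t ^ 3) / 2) / (1 - (k : ℝ) * (c1 * t ^ 3)) := by rw [e4]
      _ = c1 * ((k : ℝ) * (t ^ 2 - 1) * (3 * t + t ^ 3) / (2 * (1 - (k : ℝ) * (c1 * t ^ 3)))) := by rw [div_mul_eq_div_div]; ring
  rw [eF, eG]
  have hdSY := mul_nonneg hd10 (sub_nonneg.2 hSY)
  have hVle := hV.trans (le_of_eq eV)
  refine le_trans (add_le_add (add_le_add le_rfl hVle) le_rfl) ?_
  generalize hY : 1 - (h (n + 2) / h (n + 1)) ^ 2 = Y at hcredit hy0 ⊢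
  clear hVle hV hdef eV eG eF hhalf hF0 hwin hreads hY ecp eold eyng hstep hz2 hmono hdom hlo hL2 hf
  rcases eq_or_lt_of_le hk2 with hk22 | hk3
  · -- k = 2: `l = w`, `R = w²`; old chain with the quadratic credit
    have htw := htw2 hk22.symm
    have hk2r : (k : ℝ) = 2 := by exact_mod_cast hk22.symm
    have elw : l = w := by rw [hl, hw, show n + k = n + 2 by omega, show n + 1 + k = n + 3 by omega]
    have eRw : R = w ^ 2 := by rw [hR, hw, show n + 1 + k = n + 3 by omega]
    have h2t : 2 * (t ^ 2 - 1) ≤ σ := by rw [← hk2r]; exact hkt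
    have hσw : σ ≤ 1 - 3 / (4 * w ^ 2) := by rw [← eRw]; exact hσR
    have hSO := old_slot_two_cert ht1 hw1 htw hw54 h2t hσw hx0 hxa
    rw [eRw] at hcredit
    have hquad : 3 * c1 ^ 2 * w ^ 4 * t ^ 4 ≤ 3 / 2 * (Y ^ 2 / 2) := by
      have hdw : 0 ≤ d1 * w ^ 2 := mul_nonneg hd10 (sq_nonneg w)
      have h2c : 2 * c1 * w ^ 2 * t ^ 2 ≤ Y := by linarith only [hcredit, hdw]
      have h0 : 0 ≤ 2 * c1 * w ^ 2 * t ^ 2 := mul_nonneg (mul_nonneg (mul_nonneg zero_le_two hc10) (sq_nonneg w)) (sq_nonneg t)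
      linarith only [pow_le_pow_left₀ h0 h2c 2]
    have key : 0 ≤ c1 * (3 * w ^ 2 * t ^ 2 + 3 / 2 * x * w ^ 4 * t - w ^ 3 * t ^ 3 - t ^ 3 / (1 - x / 2)
        - 2 * (t ^ 2 - 1) * (3 * t + t ^ 3) / (2 * (1 - x))) := mul_nonneg hc10 hSO
    have equad : c1 * (3 / 2 * x * w ^ 4 * t) = 3 * c1 ^ 2 * w ^ 4 * t ^ 4 := by rw [ex, hk2r]; ring
    rw [elw]
    exact combine_two hk2r key hcredit hquad equad hdSY
  · -- k ≥ 3
    have hk3r : (3 : ℝ) ≤ k := by exact_mod_cast hk3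
    have hSO := old_slot_cert hk3r hR1 ht1 hl1 htl hly hlR hlσ hkt hσR hx0 hxa hq0 hq1 hCin
    have key : 0 ≤ c1 * (3 * R * t ^ 2 - l ^ 3 * t ^ 3 - t ^ 3 / (1 - x / k) - k * (t ^ 2 - 1) * (3 * t + t ^ 3) / (2 * (1 - x))) :=
      mul_nonneg hc10 hSO
    exact combine_three key hcredit hdSY

end Summit.QuantumFields.BalabanUV.Beta.EriceRemainderEnclosureHistoryAutonomyComparisonAgeCompositionDecaySlotFlow

end
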